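import Summits.QuantumFields.YangMills.Theorems.BalabanUVNodesN18HLayerW1SpaceRestr
import Summits.QuantumFields.YangMills.Theorems.BalabanUVNodesPortS1JacDomGeom
import Summits.QuantumFields.YangMills.Theorems.BalabanUVNodesK0RecordFormatNamesFluctE

/-!
# NODE O port PT-A — GEOMETRY OF THE v3.4 GLUE `stub_LZdetGlue` (27930, line `pta_residueW`): the record space `U^c_{k+1}(X, α₀, α₁)` is ANTITONE IN THE DOMAIN
# (consumer check C-2 of hand-27930-G3C ∕ ★★★ №565 (3), answered by a LEMMA), and THE CUBE MAP of the fluctuation index `s ↦ □(s) := cubeOfSite (blockOf s₋)` —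
# support transfer from the letter's `embIter k s₋ ∉ domSites Y` form to the `□(s) ∉ Y` form of the (63) bookkeeping, and the k-UNIFORM count of index points per cube

Cell `ym-nodeO-ideate`, porter seat `ymgap-nodeO-port-PTA-1` (gen 8); `--supports stmt-QuantumFields-27930` (helper, P0-free).  [I] = [Balaban1987RG1], [II] = [Balaban1988RG2Cluster].
* §1 ★★ `recordUc_anti` — `Y ⊆ X ⟹ recordUc … X ⊆ recordUc … Y` (NO radius hypothesis): `recordUc` is the `decodeCfg`-preimage of the `embedPair`-image of [I]'s union of orbits
  `space'` on the frame of record, whose residual recipe `RzOfRecord` is the UNIT recipe (domain-independent by `rfl`), so dag-n18's ✓`space_anti_frame` applies with condition (iv)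
  transferred by `condIV_anti_region` ([II] p.15 «restriction property»).  This is the consumer check C-2: the road evaluates the pieces `TY n Y`, `Y ⊆ X`, at `φ ∈ U^c(X)` while the
  P0-ℂ letter's (P4) grants analyticity ∕ Schur decay at `φ ∈ U^c(Y)` — the lemma closes the gap, (P4) of `P0CarrierClauses` stays as typed.
* §2 the cube map: ★ `cubeOfSite_blockOf_mem_of_embIter_mem_domSites` (a level-`k` site whose fine representative lies in the sites of `Y` has its `Mc`-cube in `Y`; exact tiling
  `domCount · L^{k+1}Mc = N₀`, centre-embedding labels), `fluct_supp_of_cube` (the letter's (P4-supp) ⟹ the cube form consumed by ✓`eventually_phiLZdet_eq_sum_lzdetPiece` ∕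
  ✓`norm_lzdetPiece_le`), ★ `card_filter_cube_le` (at most `3·d·(L·Mc)^d` non-b₀ fluctuation indices per cube — the k-uniform `V` of row (b)).

HONEST FRAMING.  Torus ∕ integer bookkeeping over the tree's own definitions; NOTHING of Bałaban's estimates asserted, ported or discharged; `stub_P0C` ∕ `stub_G3C` ∕ `stub_LZdetGlue` ∕ `stub_FE`
OPEN; 27930 OPEN (2∕6 stubs by name) · no claim; NODE O 0∕1; COUNT 8∕28 · K 1∕4 UNMOVED; finite `𝕋⁴_{L^K}` at fixed ε — NOT continuum ∕ OS ∕ Clay; **the Yang–Mills mass gap is NOT proved by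
any of this.**  No `sorry`, no `def`, no `instance`, no `notation`; standard axioms.
-/

noncomputable section

open scoped BigOperators Matrix.Norms.L2Operator

namespace Summit.QuantumFields.YangMills.Theorems.BalabanUVNodesPortS1

open Summit.QuantumFields.YangMills.Theorems.K0RecordFormatNames
open Literature.MathematicalPhysics.QuantumFieldTheory.Balaban1983to89
open Literature.MathematicalPhysics.QuantumFieldTheory.Balaban1983to89.Node00
open Literature.MathematicalPhysics.QuantumFieldTheory.Balaban1983to89.T4Continuum (T4Family)
open Literature.MathematicalPhysics.QuantumFieldTheory.Balaban1983to89.TreeLengthTorus (TPt)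
open Literature.MathematicalPhysics.QuantumFieldTheory.Balaban1983to89.B15Eq112TorusCover (cover cover_apply)
open Literature.MathematicalPhysics.QuantumFieldTheory.Balaban1983to89.B14.Eq213MaximalDomains (cubeExt side)
open Summit.QuantumFields.YangMills.BalabanUVNodes.N18HLayerW1SpaceRestr (space_anti_frame condIV_anti_region cubesI_refine frameI_X₂_plaqs_mono frameI_X₂_bonds_mono)
open Finset

variable (F : T4Family)

/-! ## §1  `U^c_{k+1}(X, α₀, α₁)` of record is antitone in the domain (consumer check C-2) -/

/-- ★★ **THE RECORD SPACE IS ANTITONE IN THE DOMAIN**: `Y ⊆ X ⟹ recordUc … X ⊆ recordUc … Y` — a pair regular on the bigger domain is regular on the smaller one (conditions (i)–(iii) have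
fewer plaquettes ∕ bonds ∕ stencils ∕ cubes to check; condition (iv) reads the UNIT residual recipe of record, the same for every domain).  No radius hypothesis.
[cite: Balaban1987RG1, (1.11)–(1.16) p.262; Balaban1988RG2Cluster, p.15 («restriction property»)] -/
theorem recordUc_anti (Mc k : ℕ) (α₀ α₁ : ℝ) (K : ℕ) {X Y : (recordDomSys F Mc k K).Dom} (h : (Y.1 : Finset _) ⊆ X.1) :
    recordUc F Mc k α₀ α₁ K X ⊆ recordUc F Mc k α₀ α₁ K Y := by
  intro u hu
  rw [mem_recordUc_iff] at hu ⊢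
  have hs : Sect2.domSites (F.P K) Mc (k + 1) Y ⊆ Sect2.domSites (F.P K) Mc (k + 1) X := W1.ClusterStep.domSites_mono h
  refine Set.image_mono ?_ hu
  refine space_anti_frame (F := Sect2.frameI (RzOfRecord F 2 K) Mc (k + 1) (Sect2.domSites (F.P K) Mc (k + 1) X))
    (F' := Sect2.frameI (RzOfRecord F 2 K) Mc (k + 1) (Sect2.domSites (F.P K) Mc (k + 1) Y))
    (Sect2.regionOfSet_plaqs_mono hs) (Sect2.regionOfSet_bonds_mono hs) (Sect2.regionOfSet_dpairs_mono hs) (cubesI_refine Mc (k + 1) hs) fun V hV => ?_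
  have hbg : (Sect2.frameI (RzOfRecord F 2 K) Mc (k + 1) (Sect2.domSites (F.P K) Mc (k + 1) Y)).bg =
      (Sect2.frameI (RzOfRecord F 2 K) Mc (k + 1) (Sect2.domSites (F.P K) Mc (k + 1) X)).bg := rfl
  rw [hbg]
  exact condIV_anti_region (frameI_X₂_plaqs_mono _ _ Mc (k + 1) hs) (frameI_X₂_bonds_mono _ _ Mc (k + 1) hs) hV

/-- The same read on pairs: `encodeCfg φ ∈ recordUc … X → encodeCfg φ ∈ recordUc … Y` for `Y ⊆ X`. [cite: Balaban1987RG1, (1.11)–(1.16) p.262; Balaban1988RG2Cluster, p.15] -/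
theorem encodeCfg_mem_recordUc_anti (Mc k : ℕ) (α₀ α₁ : ℝ) (K : ℕ) {X Y : (recordDomSys F Mc k K).Dom} (h : (Y.1 : Finset _) ⊆ X.1)
    {φ : Sect2.CPair (F.P K) (MatA 2)} (hφ : encodeCfg F K φ ∈ recordUc F Mc k α₀ α₁ K X) : encodeCfg F K φ ∈ recordUc F Mc k α₀ α₁ K Y :=
  recordUc_anti F Mc k α₀ α₁ K h hφ

/-! ## §2  The cube map `s ↦ □(s) = cubeOfSite (blockOf s₋)` of the fluctuation index: support transfer and the per-cube count -/

variable {F}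

/-- On the tiled range the standing-range inequality `k + 1 ≤ m + K` holds. [cite: Balaban1987RG1, p.257 (bookkeeping)] -/
theorem succ_le_m_add_K_of_recordK₀_le {Mc k K : ℕ} (hK : recordK₀ F Mc k ≤ K) : k + 1 ≤ (F.P K).m + (F.P K).K := by
  rw [F.P_K, F.P_m]; unfold recordK₀ at hK; omega

/-- ★ **A LEVEL-`k` SITE WHOSE FINE REPRESENTATIVE LIES IN THE SITES OF `Y` HAS ITS `Mc`-CUBE IN `Y`** (tiled range): `embIter k x ∈ domSites Y ⟹ cubeOfSite (blockOf x) ∈ Y`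
(the fine label of `embIter k x` is `L^k·x + (L^k − 1)∕2`, its `L^{k+1}Mc`-cube label is `⌊x ∕ (L·Mc)⌋ = ⌊⌊x∕L⌋ ∕ Mc⌋`; a site of the `L^{k+1}Mc`-cube of index `q` has label `q`,
uniquely because `domCount · L^{k+1}Mc = N₀`). [cite: Balaban1987RG1, p.257 (the cubes π_j), (0.1) p.251] -/
theorem cubeOfSite_blockOf_mem_of_embIter_mem_domSites {Mc k K : ℕ} (hMc : McGuard F Mc) (hK : recordK₀ F Mc k ≤ K) (Y : (recordDomSys F Mc k K).Dom)
    (x : Site (F.P K) k) (hx : B15DeterminingSets.embIter k x ∈ Sect2.domSites (F.P K) Mc (k + 1) Y) :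
    cubeOfSite F Mc k K (blockOf x) ∈ (Y.1 : Finset (TPt (F.P K).d (Sect2.domCount (F.P K) Mc (k + 1)))) := by
  have hk := succ_le_m_add_K_of_recordK₀_le hK
  have hMc0 := PortHRecordRowG.mc_pos hMc
  have hL : 0 < F.L := by have := F.hL.2; omega
  rw [Sect2.domSites, Set.mem_iUnion₂] at hx
  obtain ⟨q, hq, hxq⟩ := hx
  -- the cube of index `q`: its sites have labels in `[s·q_μ, s·q_μ + s − 1]`, `s = L^{k+1}·Mc`
  obtain ⟨z, hz, hzx⟩ := hxq
  have htile : Sect2.domCount (F.P K) Mc (k + 1) * (F.L ^ (k + 1) * Mc) = (F.P K).sitesPerDir 0 := domCount_mul_side_eq hMc hK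
  have hside : side (F.P K).L Mc (k + 1) = F.L ^ (k + 1) * Mc := rfl
  suffices h : cubeOfSite F Mc k K (blockOf x) = q by rw [h]; exact hq
  funext μ
  obtain ⟨hz1, hz2⟩ := hz μ
  rw [hside, Nat.zero_mul, Nat.cast_zero, sub_zero] at hz1
  rw [hside, Nat.zero_mul, Nat.cast_zero, add_zero] at hz2
  have hliftq : Sect2.liftIdx (F.P K) q μ = ((q μ).val : ℤ) := rfl
  rw [hliftq] at hz1 hz2
  set s : ℕ := F.L ^ (k + 1) * Mc with hs
  have hs0 : 0 < s := by positivity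
  have hqlt : (q μ).val < Sect2.domCount (F.P K) Mc (k + 1) := ZMod.val_lt _
  -- `0 ≤ z_μ < N₀`, so the fine label of `embIter k x` IS `z_μ`
  have hz0 : 0 ≤ z μ := le_trans (by positivity) hz1
  have hzN : z μ < ((F.P K).sitesPerDir 0 : ℤ) := by
    have h1 : ((q μ).val : ℤ) + 1 ≤ Sect2.domCount (F.P K) Mc (k + 1) := by exact_mod_cast hqlt
    have h2 : (s : ℤ) * ((q μ).val + 1) ≤ (s : ℤ) * Sect2.domCount (F.P K) Mc (k + 1) := mul_le_mul_of_nonneg_left h1 (by positivity)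
    have h3 : ((s : ℤ) * Sect2.domCount (F.P K) Mc (k + 1) : ℤ) = ((F.P K).sitesPerDir 0 : ℤ) := by rw [← htile]; push_cast; ring
    linarith
  have hval : (((B15DeterminingSets.embIter k x) μ).val : ℤ) = z μ := by
    have e := congrFun hzx μ
    rw [cover_apply] at e
    rw [← e, ZMod.val_intCast, Int.emod_eq_of_lt hz0 hzN]
  -- hence `⌊label ∕ s⌋ = q_μ`
  have hdivz : ((B15DeterminingSets.embIter k x) μ).val / s = (q μ).val := by
    have e1 : (s : ℤ) * (q μ).val ≤ (((B15DeterminingSets.embIter k x) μ).val : ℤ) := by rw [hval]; exact hz1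
    have e2 : (((B15DeterminingSets.embIter k x) μ).val : ℤ) < (s : ℤ) * (q μ).val + s := by rw [hval]; linarith
    have e1' : s * (q μ).val ≤ ((B15DeterminingSets.embIter k x) μ).val := by exact_mod_cast e1
    have e2' : ((B15DeterminingSets.embIter k x) μ).val < s * (q μ).val + s := by exact_mod_cast e2
    refine Nat.div_eq_of_lt_le (by rw [mul_comm]; exact e1') ?_
    rw [add_mul, one_mul, mul_comm]; exact e2'
  -- and `⌊label ∕ s⌋ = ⌊⌊x∕L⌋ ∕ Mc⌋` by the centre-embedding labels
  have hdiv2 : ((B15DeterminingSets.embIter k x) μ).val / s = ((blockOf x) μ).val / Mc := by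
    have hvx : ((B15DeterminingSets.embIter k x) μ).val / F.L ^ k = (x μ).val := B14.Eq213DetSet.val_embIter_div (by omega) x μ
    rw [Site.val_blockOf hk, hs, pow_succ, mul_assoc, ← Nat.div_div_eq_div_mul, hvx, Nat.div_div_eq_div_mul]
    rfl
  show ((((blockOf x) μ).val / Mc : ℕ) : ZMod (Sect2.domCount (F.P K) Mc (k + 1))) = q μ
  rw [← hdiv2, hdivz, ZMod.natCast_zmod_val]

/-- **SUPPORT TRANSFER**: the letter's (P4-supp) «`TY Y φ i j = 0` unless both fine representatives lie in the sites of `Y`» implies the cube form «`= 0` unless both cubes lie in `Y`» consumed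
by the (63) bookkeeping (✓`eventually_phiLZdet_eq_sum_lzdetPiece`, ✓`norm_lzdetPiece_le`), for the cube map `s ↦ cubeOfSite (blockOf s₋)` on the non-b₀ index.
[cite: Balaban1987RG1, (1.7) p.261, p.257] -/
theorem fluct_supp_of_cube {Mc k K : ℕ} (hMc : McGuard F Mc) (hK : recordK₀ F Mc k ≤ K) {β : Type*}
    {TYK : (recordDomSys F Mc k K).Dom → β → FluctIdx F k K → FluctIdx F k K → ℂ}
    (hsupp : ∀ (Y : (recordDomSys F Mc k K).Dom) (φ : β) (i j : FluctIdx F k K),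
      (B15DeterminingSets.embIter k i.1.src ∉ Sect2.domSites (F.P K) Mc (k + 1) Y ∨
        B15DeterminingSets.embIter k j.1.src ∉ Sect2.domSites (F.P K) Mc (k + 1) Y) → TYK Y φ i j = 0)
    (Y : (recordDomSys F Mc k K).Dom) (φ : β) (s s' : NonB0Idx F k K)
    (h : cubeOfSite F Mc k K (blockOf s.1.1.src) ∉ (Y.1 : Finset (TPt (F.P K).d (Sect2.domCount (F.P K) Mc (k + 1)))) ∨
      cubeOfSite F Mc k K (blockOf s'.1.1.src) ∉ (Y.1 : Finset (TPt (F.P K).d (Sect2.domCount (F.P K) Mc (k + 1))))) :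
    TYK Y φ s.1 s'.1 = 0 := by
  refine hsupp Y φ s.1 s'.1 ?_
  rcases h with h | h
  · exact Or.inl fun hm => h (cubeOfSite_blockOf_mem_of_embIter_mem_domSites hMc hK Y _ hm)
  · exact Or.inr fun hm => h (cubeOfSite_blockOf_mem_of_embIter_mem_domSites hMc hK Y _ hm)

/-- The `Mc`-cube label of a level-`k` site through its `(k+1)`-block: `(cubeOfSite (blockOf x))_μ = ⌊x_μ ∕ (L·Mc)⌋` below `domCount` (tiled range).
[cite: Balaban1987RG1, p.257 (bookkeeping)] -/
theorem val_div_mul_lt_domCount {Mc k K : ℕ} (hMc : McGuard F Mc) (hK : recordK₀ F Mc k ≤ K) (x : Site (F.P K) k) (μ : Fin (F.P K).d) :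
    (x μ).val / (F.L * Mc) < Sect2.domCount (F.P K) Mc (k + 1) := by
  have hk := succ_le_m_add_K_of_recordK₀_le hK
  have hMc0 := PortHRecordRowG.mc_pos hMc
  have hL : 0 < F.L := by have := F.hL.2; omega
  have h1 : (x μ).val < (F.P K).sitesPerDir k := ZMod.val_lt _
  have h2 : (F.P K).sitesPerDir k = Sect2.domCount (F.P K) Mc (k + 1) * Mc * F.L := by
    rw [(F.P K).sitesPerDir_eq_mul_succ hk, PortHRecordRowG.sitesPerDir_eq_domCount_mul hMc hK, F.P_L]
  rw [Nat.div_lt_iff_lt_mul (by positivity)]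
  calc (x μ).val < (F.P K).sitesPerDir k := h1
    _ = Sect2.domCount (F.P K) Mc (k + 1) * Mc * F.L := h2
    _ = Sect2.domCount (F.P K) Mc (k + 1) * (F.L * Mc) := by ring

/-- **AT MOST `(L·Mc)^d` LEVEL-`k` SITES PER `Mc`-CUBE** (tiled range): the sites with a given cube label are determined by their labels modulo `L·Mc`.
[cite: Balaban1987RG1, p.257 (bookkeeping)] -/
theorem card_filter_site_cube_le {Mc k K : ℕ} (hMc : McGuard F Mc) (hK : recordK₀ F Mc k ≤ K) (q : TPt (F.P K).d (Sect2.domCount (F.P K) Mc (k + 1))) :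
    (univ.filter fun x : Site (F.P K) k => cubeOfSite F Mc k K (blockOf x) = q).card ≤ (F.L * Mc) ^ (F.P K).d := by
  classical
  have hk := succ_le_m_add_K_of_recordK₀_le hK
  have hMc0 := PortHRecordRowG.mc_pos hMc
  have hL : 0 < F.L := by have := F.hL.2; omega
  have hLM : 0 < F.L * Mc := by positivity
  -- the label of the cube of `x` in direction `μ` is `⌊x_μ ∕ (L·Mc)⌋ (mod domCount)`
  have hlab : ∀ (x : Site (F.P K) k) (μ : Fin (F.P K).d),
      cubeOfSite F Mc k K (blockOf x) μ = (((x μ).val / (F.L * Mc) : ℕ) : ZMod (Sect2.domCount (F.P K) Mc (k + 1))) := by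
    intro x μ
    show ((((blockOf x) μ).val / Mc : ℕ) : ZMod (Sect2.domCount (F.P K) Mc (k + 1))) = _
    rw [Site.val_blockOf hk, Nat.div_div_eq_div_mul, F.P_L]
  let f : Site (F.P K) k → (Fin (F.P K).d → Fin (F.L * Mc)) := fun x μ => ⟨(x μ).val % (F.L * Mc), Nat.mod_lt _ hLM⟩
  calc (univ.filter fun x : Site (F.P K) k => cubeOfSite F Mc k K (blockOf x) = q).card
      ≤ (univ : Finset (Fin (F.P K).d → Fin (F.L * Mc))).card := by
        refine Finset.card_le_card_of_injOn f (fun _ _ => Finset.mem_coe.2 (Finset.mem_univ _)) ?_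
        intro x hx x' hx' hff
        rw [Finset.mem_coe, Finset.mem_filter] at hx hx'
        funext μ
        have hq : (((x μ).val / (F.L * Mc) : ℕ) : ZMod (Sect2.domCount (F.P K) Mc (k + 1))) = (((x' μ).val / (F.L * Mc) : ℕ) : ZMod _) := by
          rw [← hlab, ← hlab, hx.2, hx'.2]
        have hdiv : (x μ).val / (F.L * Mc) = (x' μ).val / (F.L * Mc) := by
          have h := (ZMod.natCast_eq_natCast_iff' _ _ _).1 hq
          rwa [Nat.mod_eq_of_lt (val_div_mul_lt_domCount hMc hK x μ), Nat.mod_eq_of_lt (val_div_mul_lt_domCount hMc hK x' μ)] at h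
        have hmod : (x μ).val % (F.L * Mc) = (x' μ).val % (F.L * Mc) := by
          have h := congrFun hff μ
          simp only [f, Fin.mk.injEq] at h
          exact h
        apply ZMod.val_injective
        rw [← Nat.div_add_mod (x μ).val (F.L * Mc), ← Nat.div_add_mod (x' μ).val (F.L * Mc), hdiv, hmod]
    _ = (F.L * Mc) ^ (F.P K).d := by rw [Finset.card_univ, Fintype.card_fun, Fintype.card_fin, Fintype.card_fin]

/-- ★ **AT MOST `3·d·(L·Mc)^d` NON-b₀ FLUCTUATION INDICES PER `Mc`-CUBE** (tiled range) — the k-UNIFORM site count `V` of row (b) (✓`norm_lzdetPiece_le`): an index is a level-`k` bond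
`(x, μ)` with its cube read at `x`, times a colour `a ∈ Fin 3`. [cite: Balaban1987RG1, p.257, (2.11) p.267 (bookkeeping)] -/
theorem card_filter_cube_le {Mc k K : ℕ} (hMc : McGuard F Mc) (hK : recordK₀ F Mc k ≤ K) (q : TPt (F.P K).d (Sect2.domCount (F.P K) Mc (k + 1))) :
    (univ.filter fun s : NonB0Idx F k K => cubeOfSite F Mc k K (blockOf s.1.1.src) = q).card ≤ 3 * (F.P K).d * (F.L * Mc) ^ (F.P K).d := by
  classical
  let g : NonB0Idx F k K → (Site (F.P K) k × Fin (F.P K).d) × Fin 3 := fun s => ((s.1.1.src, s.1.1.dir), s.1.2)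
  have hg : Function.Injective g := by
    rintro ⟨⟨⟨x, μ⟩, a⟩, h⟩ ⟨⟨⟨x', μ'⟩, a'⟩, h'⟩ hgg
    simp only [g, Prod.mk.injEq] at hgg
    obtain ⟨⟨rfl, rfl⟩, rfl⟩ := hgg
    rfl
  calc (univ.filter fun s : NonB0Idx F k K => cubeOfSite F Mc k K (blockOf s.1.1.src) = q).card
      ≤ (((univ.filter fun x : Site (F.P K) k => cubeOfSite F Mc k K (blockOf x) = q) ×ˢ (univ : Finset (Fin (F.P K).d))) ×ˢ
          (univ : Finset (Fin 3))).card := by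
        refine Finset.card_le_card_of_injOn g (fun s hs => ?_) (hg.injOn)
        rw [Finset.mem_coe, Finset.mem_filter] at hs
        exact Finset.mem_coe.2 (Finset.mem_product.2 ⟨Finset.mem_product.2 ⟨Finset.mem_filter.2 ⟨Finset.mem_univ _, hs.2⟩, Finset.mem_univ _⟩,
          Finset.mem_univ _⟩)
    _ ≤ 3 * (F.P K).d * (F.L * Mc) ^ (F.P K).d := by
        rw [Finset.card_product, Finset.card_product, Finset.card_univ, Finset.card_univ, Fintype.card_fin, Fintype.card_fin]
        have h := card_filter_site_cube_le hMc hK q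
        calc (univ.filter fun x : Site (F.P K) k => cubeOfSite F Mc k K (blockOf x) = q).card * (F.P K).d * 3
            ≤ (F.L * Mc) ^ (F.P K).d * (F.P K).d * 3 := by gcongr
          _ = 3 * (F.P K).d * (F.L * Mc) ^ (F.P K).d := by ring

end Summit.QuantumFields.YangMills.Theorems.BalabanUVNodesPortS1

end
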